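import Summits.QuantumAdvantage.QuantumAdvantage.Theorems.SparsityDial
import Summits.QuantumAdvantage.QuantumAdvantage.Theorems.AnchorDialFrozen
import Summits.QuantumAdvantage.QuantumAdvantage.Theorems.AnchorDialOrbit

/-!
# SparsityDial — REV 1 / REV 2 additions (Theorems twin `SparsityDialTwin.lean` a9a06cd9, cell decomp-qadv, seat lens-2 g18;
supports item 27138 `StabilizerDial.StabGenericLossPos3`).  The g18 rev-0 twin (8e2eeed1) is in the tree as `SparsityDialA` / `SparsityDialB` /
`SparsityDial`; this delta carries, verbatim and in order, everything the refreshed twin ADDS after `split_nondegenerate` … `blockAntipodalLoss3_of_sparse`: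
* §5 (cont.) the S-rung PROVED: `mem_dev_bpStrat_iff`, `dev_bpStrat_flip2`, `bpStrat_quarter_loss` (landed frozen law `AnchorDial.frozen_loss_count`),
  `blockAntipodalLoss3 : BlockAntipodalLoss3`;
* §5b the PROVED D-rung: `lbStrat` (long block-antipodal family), `lbStrat_not_sparse` (class membership), `LongBlockLoss3`,
  `longBlockLoss3_of_dense`, `longBlockLoss3`; `real_loss_of_quarter`;
* §5c the FROZEN-16 LAW: `epat`, `shiftAt`, `core_frozen16` (decide), `grpOf`, `exists_epat`, `zV`, `frozen16_orbit_loses`,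
  `frozen16_loss_count`, `real_loss_of_frac`, `acStrat_sixteenth_loss`, `AcLoss3`, `acLoss3`.
No `sorry`; standard axioms; no instances, no notation, no unsafe options.  (Docstring-only edits of the refreshed twin to the already-landed
`split_nondegenerate` / `blockAntipodalLoss3_of_sparse` are not re-landed: tree files are append-only.)
-/

set_option linter.dupNamespace false
set_option linter.unusedVariables false

noncomputable section

open scoped Classical

namespace Summit.QuantumAdvantage.QuantumAdvantage.Theorems.SparsityDial

open Finset
open Literature.Computability.QuantumComplexity Literature.Computability.QuantumComplexity.RingHLF
open Literature.Computability.MetaComplexity Literature.Computability.MetaComplexity.Smolensky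
open Summit.QuantumAdvantage.AdviceFreeQNC0
open Summit.QuantumAdvantage.QuantumAdvantage.Theses (ExactnessDial.PolyLossOddU3 ExactnessDial.DPLift3)
open Summit.QuantumAdvantage.QuantumAdvantage.Theorems.HolonomyDial (selP selP_mem selP_apply xorP xorP_mem
  xorP_apply_bool tPoly tPoly_mem tPoly_apply closes_T)
open Summit.QuantumAdvantage.QuantumAdvantage.Theorems.AnchorDial (outB dev loss_shape_mono card_odd_ge flip2 flip2_apply_of_ne
  Frozen OneGap frozen_loss_count)
open Summit.QuantumAdvantage.QuantumAdvantage.Theorems.HolonomyDial (card_odd_le)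
open Summit.QuantumAdvantage.QuantumAdvantage.Theorems.LocusDial (Coverable FewLocus FewLocusLossOne3
  coverable_mono_m Coverable.card_le dev_tPoly fewLocusLossOne3_of_fewLocusLoss3)
open Summit.QuantumAdvantage.QuantumAdvantage.Theorems.StabilizerDial (StabFew pad pad_mem winset_pad deg_pad_stab
  stabFew_of_fewLocus bitP bitP_pad rowMask apIdx apStrat apStrat_mem bitP_apStrat mem_dev_pad_apStrat_iff BlockRec
  fibreIdentityAt_of_block oddSliceBound_holds goodBound_of_blockRec blockSelect_of_fewLocus eventually_polylog
  side_bounds polyLossOddU3_of_stabPos stabGenericLossPos3_of_polyLossOddU3 antipodalGenericPos3)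

variable {N : ℕ}

/-! ### The S-rung is a THEOREM: the block-antipodal family loses a QUARTER of the odd class — by the landed
FROZEN LAW (`AnchorDial.frozen_loss_count`, level 0 of the sensitivity dial): its deviation set lies in one gap and
is frozen under the two adjacent pair-flips at `6k+1, 6k+2` / `6k+3, 6k+4`, which touch neither the block nor its
antipodal image; the three exclusion parities then force a loss at one of the four orbit points. -/

/-- membership in the deviation set of the (unpadded) block-antipodal family. -/
theorem mem_dev_bpStrat_iff (k : ℕ) (y : Fin N → Bool) (j : Fin N) :
    j ∈ dev (fun i : Fin N => bpStrat k i) y ↔ (1 ≤ j.val ∧ j.val < 1 + 6 * k) ∧ y (apIdx j) = true := by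
  unfold Summit.QuantumAdvantage.QuantumAdvantage.Theorems.AnchorDial.dev
  rw [mem_filter]
  show (j ∈ (univ : Finset (Fin N)) ∧ decide (bpStrat k j y = 1) ≠ tGuess y j) ↔ _
  simp only [mem_univ, true_and]
  by_cases hj : 1 ≤ j.val ∧ j.val < 1 + 6 * k
  · have hb : bpStrat k j = apStrat j := by unfold bpStrat; rw [if_pos hj]
    have hd : decide (bpStrat k j y = 1) = xor (tGuess y j) (y (apIdx j)) := by
      rw [hb]; exact bitP_apStrat j y
    rw [hd]
    simp only [hj, true_and]
    generalize tGuess y j = t; generalize y (apIdx j) = q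
    cases t <;> cases q <;> decide
  · have hb : bpStrat k j = tPoly j := by unfold bpStrat; rw [if_neg hj]
    have ht : decide (bpStrat k j y = 1) = tGuess y j := by
      rw [hb, tPoly_apply]; generalize tGuess y j = t; cases t <;> decide
    rw [ht]
    simp only [hj, false_and, iff_false, ne_eq, not_not]

/-- the block-antipodal deviation set is FROZEN under an adjacent pair-flip past the block and before the antipodes. -/
theorem dev_bpStrat_flip2 (k : ℕ) (hN : 6 * k + 8 ≤ N / 2) (y : Fin N → Bool) {a : ℕ} (ha1 : 6 * k + 1 ≤ a)
    (ha2 : a + 2 ≤ N / 2) :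
    dev (fun i : Fin N => bpStrat k i) (flip2 a (a + 1) y) = dev (fun i : Fin N => bpStrat k i) y := by
  ext j
  rw [mem_dev_bpStrat_iff, mem_dev_bpStrat_iff]
  constructor
  · rintro ⟨hj, hy⟩
    have hv : (apIdx j).val = j.val + N / 2 := by
      show (j.val + N / 2) % N = _; exact Nat.mod_eq_of_lt (by omega)
    rw [flip2_apply_of_ne y (by omega) (by omega)] at hy
    exact ⟨hj, hy⟩
  · rintro ⟨hj, hy⟩
    have hv : (apIdx j).val = j.val + N / 2 := by
      show (j.val + N / 2) % N = _; exact Nat.mod_eq_of_lt (by omega)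
    refine ⟨hj, ?_⟩
    rw [flip2_apply_of_ne y (by omega) (by omega)]
    exact hy

/-- **quarter loss of the block-antipodal family** (frozen law at sites `6k+1`, `6k+3`). -/
theorem bpStrat_quarter_loss (k : ℕ) (hN : 6 * k + 8 ≤ N / 2) :
    (univ.filter fun x : Fin N → Bool => OddZeros x).card ≤
      4 * (univ.filter fun x : Fin N → Bool =>
        OddZeros x ∧ ¬ Rel x (outB (fun i : Fin N => bpStrat k i) x)).card := by
  set P : Fin N → CubeFn (ZMod 3) N := fun i => bpStrat k i with hP
  have hN3 : 3 ≤ N := by omega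
  have hfro : ∀ x : Fin N → Bool, Frozen P (6 * k + 1) (6 * k + 3) x := by
    intro x
    refine ⟨dev_bpStrat_flip2 k hN x (by omega) (by omega), dev_bpStrat_flip2 k hN x (by omega) (by omega), ?_⟩
    rw [dev_bpStrat_flip2 k hN _ (a := 6 * k + 1) (by omega) (by omega),
      dev_bpStrat_flip2 k hN x (a := 6 * k + 3) (by omega) (by omega)]
  have hgap : ∀ x : Fin N → Bool, OneGap P (6 * k + 1) (6 * k + 3) x := fun x =>
    Or.inl fun i hi => by have := ((mem_dev_bpStrat_iff k x i).1 hi).1; omega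
  have h := frozen_loss_count hN3 (a₁ := 6 * k + 1) (a₂ := 6 * k + 3) (by omega) (by omega) P
  have heq : (univ.filter fun x : Fin N → Bool => OddZeros x) =
      (univ.filter fun x : Fin N → Bool =>
        OddZeros x ∧ Frozen P (6 * k + 1) (6 * k + 3) x ∧ OneGap P (6 * k + 1) (6 * k + 3) x) := by
    ext x
    simp only [mem_filter, mem_univ, true_and]
    exact ⟨fun hx => ⟨hx, hfro x, hgap x⟩, fun hx => hx.1⟩
  rw [heq]
  exact h

/-- **THE S-RUNG, PROVED**: `BlockAntipodalLoss3` (with `C = 1`: win rate `≤ 3/4 ≤ 1 − 1/n` for large `n`). -/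
theorem blockAntipodalLoss3 : BlockAntipodalLoss3 := by
  obtain ⟨n₀, hn₀⟩ := eventually_polylog (6 * 279936 + 8) 4
  refine ⟨1, max n₀ 8, fun n hn => ?_⟩
  obtain ⟨hK, hL⟩ := hn₀ n (le_of_max_le_left hn)
  have h8 : 8 ≤ n := le_of_max_le_right hn
  set L := Nat.log 2 n with hLdef
  have hL1 : 1 ≤ L := by omega
  have hkb : kBlk n 2 ≤ 279936 * L ^ (2 * 2) := kBlk_le (N := n) 2 hL1
  have hL4 : 1 ≤ L ^ 4 := Nat.one_le_pow _ _ hL1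
  have hcond : 6 * kBlk n 2 + 8 ≤ n / 2 := by
    have : 6 * kBlk n 2 + 8 ≤ (6 * 279936 + 8) * L ^ 4 := by
      have h' : L ^ (2 * 2) = L ^ 4 := by norm_num
      rw [h'] at hkb
      nlinarith
    omega
  have hq := bpStrat_quarter_loss (N := n) (kBlk n 2) hcond
  set W := (univ.filter fun x : Fin n → Bool =>
    OddZeros x ∧ Rel x (fun i => decide (bpStrat (kBlk n 2) i x = 1))).card with hW
  set Lo := (univ.filter fun x : Fin n → Bool =>
    OddZeros x ∧ ¬ Rel x (fun i => decide (bpStrat (kBlk n 2) i x = 1))).card with hLo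
  set O := (univ.filter fun x : Fin n → Bool => OddZeros x).card with hO
  have hq' : O ≤ 4 * Lo := hq
  have hsplit : W + Lo = O := by
    have hs := Finset.card_filter_add_card_filter_not
      (s := univ.filter fun x : Fin n → Bool => OddZeros x)
      (fun x : Fin n → Bool => Rel x (fun i => decide (bpStrat (kBlk n 2) i x = 1)))
    rw [filter_filter, filter_filter] at hs
    exact hs
  have hOle : O ≤ 2 ^ (n - 1) := card_odd_le (n := n) (by omega)
  have h4 : 4 * W ≤ 3 * 2 ^ (n - 1) := by omega
  -- real form with C = 1
  have hn0 : (0 : ℝ) < (n : ℝ) := by exact_mod_cast (show 0 < n by omega)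
  have hW' : (4 : ℝ) * (W : ℝ) ≤ 3 * (2 : ℝ) ^ (n - 1) := by exact_mod_cast h4
  have hpow : (0 : ℝ) < (2 : ℝ) ^ (n - 1) := by positivity
  have hn4 : (4 : ℝ) ≤ (n : ℝ) := by exact_mod_cast (show 4 ≤ n by omega)
  rw [pow_one]
  have hfrac : (3 : ℝ) / 4 ≤ 1 - 1 / (n : ℝ) := by
    rw [div_le_iff₀ (by norm_num : (0 : ℝ) < 4)]
    have : 1 / (n : ℝ) ≤ 1 / 4 := one_div_le_one_div_of_le (by norm_num) hn4
    nlinarith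
  calc (W : ℝ) ≤ 3 / 4 * (2 : ℝ) ^ (n - 1) := by nlinarith
    _ ≤ (1 - 1 / (n : ℝ)) * (2 : ℝ) ^ (n - 1) := by nlinarith



end Summit.QuantumAdvantage.QuantumAdvantage.Theorems.SparsityDial
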